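import Summits.Ventures.PercRepro.GenQHyperplaneRowsA

/-!
# PercRepro — the rank-6 block, part C: no rank-`r` `j`-subset has `j < r` points (night-4, gen 24)

`spSum_eq_zero_of_card_lt_rank`: `SP_{s,j}^{(r)} = 0` for `j < r` (a set of `j` points has rank `≤ j`) — the row
(A6_j) of the rank-6 block at `j = 6` sums the rank-`7` `6`-subsets, which do not exist.  Imports `GenQHyperplaneRowsA`.
-/
namespace PercRepro.Night4

open Finset ThmH SixFour GenQ PerFlat Star

variable {α : Type*} [DecidableEq α] {M : Matroid α} [M.Finite]

/-- `SP_{s,j}^{(r)} = 0` for `j < r`: a `j`-point set has rank `≤ j < r`. -/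
theorem spSum_eq_zero_of_card_lt_rank (G : Finset α) {r j : ℕ} (hjr : j < r) (s : ℕ) :
    spSum M G r s j = 0 := by
  unfold spSum
  refine Finset.sum_eq_zero (fun H _ => ?_)
  unfold spF
  rw [Finset.card_eq_zero, Finset.filter_eq_empty_iff]
  intro T hT hTr
  rw [Finset.mem_powersetCard] at hT
  have h1 := M.eRk_le_encard (T : Set α)
  rw [Set.encard_coe_eq_coe_finsetCard, hT.2, hTr] at h1
  have h2 : r ≤ j := by exact_mod_cast h1
  omega

end PercRepro.Night4
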